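import Summits.Parity.GeneralizedHardyLittlewood.Theses.LiouvilleMAD
import Summits.Parity.GeneralizedHardyLittlewood.Theses.LiouvilleShiftedTables
import Summits.Parity.GeneralizedHardyLittlewood.Theses.DicksonFibration
import Summits.Parity.GeneralizedHardyLittlewood.Theorems.LiouvilleMADEngineToGHL

/-!
# Line `Sketch` for the crux `EngineToGHL` (stmt-Parity-14995) — the honest ONE-STUB skeleton

Lead c1 (prover-line-stmt-Parity-14995-c1-0), owning the picked line `Sketch` (ideator 2, cards
hinge-rails-subsumption + class-blind-vaughan-dichotomy).  The line's composition is
`g₁ → g₂ → g₃ → g₄ → PairsToGHL → EngineToGHL`; the glue `g₁ ∧ g₂ ∧ g₃ ∧ g₄` is the tree theorem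
`Theorems.EngineToGHL.glue` (p95950, c0 lead), so exactly ONE stub is left, and it is VERBATIM the
existing shared item stmt-Parity-9389 (`LiouvilleShiftedTables.PairsToGHL`), equivalently
`PairsHL → DicksonFibration.DimOne` (stmt-Parity-0819) by `engineToGHL_iff_pairsHL_imp_dimOne`.
The stub is therefore NOT briefed to a worker and NOT re-filed (it has its own seats); this file
records the composition for the gate (`ledger skeleton check`) and for the disprover / consult.

Sub-goals landed around the stub by the c1 lead (all `--supports stmt-Parity-14995`):
* `Theorems/LiouvilleMADEngineToGHLIllusory.lean` (p96563) — negative lane: modulo Matomäki–Merikoski,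
  `UnboundedSiegelZeros → PairsHL → ¬EngineToGHL`; the four hypotheses of `closes` bound Siegel zeros;
  `EngineToGHL ↔ GHL ∨ ¬PairsHL`.
* `Theorems/LiouvilleMADEngineToGHLPairsReachTools.lean` (p98151) and
  `Theorems/LiouvilleMADEngineToGHLPairsReach.lean` — the exact reach of `PairsHL` inside `DimOne`
  (unit-slope pairs, bounded shift difference, all convex `K`, `|bᵢ| ≤ L N`), `PairsHL ↔ reach`, and
  `EngineToGHL ↔ (reach → DimOne)`: the stub asks for the three axes `t ≥ 3`, general slopes,
  shift differences up to `2 L N`.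
-/

namespace Summit.Parity.GeneralizedHardyLittlewood.Cruxes.EngineToGHL.Sketch

open Summit.Parity.GeneralizedHardyLittlewood.Theses
open Summit.Parity.GeneralizedHardyLittlewood.Theses.LiouvilleMAD

/-- **The one stub of line `Sketch`** = the shared residual `PairsToGHL` (stmt-Parity-9389):
Hardy–Littlewood pairs at every fixed shift `h ≥ 1` imply Green–Tao's Conjecture 1.2 (all `d`,
`t`, `L`, convex `K`).  Open (prime `k`-tuples `k ≥ 3`, general slopes, shift-uniformity
`|bᵢ| ≤ L N`); held behind `DicksonFibration.DimOne` (stmt-Parity-0819). [conjecture] -/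
theorem stub_pairsToGHL : LiouvilleShiftedTables.PairsToGHL := by
  sorry

/-- **Composition of line `Sketch`.** The crux BY NAME from its one stub, through the proved glue
(`Theorems.EngineToGHL.engineToGHL_of_pairsToGHL`). [folklore] -/
theorem EngineToGHL_of : EngineToGHL :=
  Theorems.EngineToGHL.engineToGHL_of_pairsToGHL stub_pairsToGHL

/-- The same composition with the stub as an explicit hypothesis (kernel-checked, sorry-free):
any proof of stmt-Parity-9389 closes stmt-Parity-14995. [folklore] -/
theorem EngineToGHL_of_stub (h : LiouvilleShiftedTables.PairsToGHL) : EngineToGHL :=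
  Theorems.EngineToGHL.engineToGHL_of_pairsToGHL h

/-- Alternative single stub: `DimOne` (stmt-Parity-0819) also closes the crux, through the
proved fibration lemma `DicksonFibration.Assembly_holds` (stmt-Parity-0822). [folklore] -/
theorem EngineToGHL_of_dimOne (hD : DicksonFibration.DimOne) : EngineToGHL :=
  Theorems.EngineToGHL.engineToGHL_of_dimOne hD

end Summit.Parity.GeneralizedHardyLittlewood.Cruxes.EngineToGHL.Sketch
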